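import Summits.Ventures.HodgeRepro2.T5SU11JacobiIntegerWeight
import Summits.Ventures.HodgeRepro2.T5SU11XiTransform
import Mathlib.Analysis.SpecialFunctions.Gamma.Deriv

/-!
# The Jacobi transform `λ ↦ m̂_k(λ)` is continuous and differentiable on its strip; its derivative
vanishes at the critical parameter `λ = 1`; the removable singularities of the elementary formulas

On the strip `2 − k < λ < k` the Jacobi transform of the weight-`k` coefficient modulus,
`m̂_k(λ) = ∫_G (1 − |g·0|²)^{k/2} φ_λ dν`, is given by the Gamma quotient of `T5SU11JacobiTransform`, all of
whose Gamma arguments are positive; with Mathlib's `Real.differentiableAt_Gamma` this makes `λ ↦ m̂_k(λ)`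
**continuous** (`continuousOn_jacobi`) and **differentiable** (`differentiableOn_jacobi`,
`differentiableAt_jacobi`) on the strip. Since `λ = 1` is the minimum of the transform on the strip
(`T5SU11XiTransform.xi_transform_le_jacobi`), Fermat's theorem gives **`(d/dλ) m̂_k(λ) |_{λ=1} = 0`**
(`deriv_jacobi_one`, `hasDerivAt_jacobi_one`). Continuity also settles the removable singularities of the
elementary integer-weight formulas without any L'Hôpital argument: **`2π(1 − λ)/cos(πλ/2) → 4` as
`λ → 1`** (`tendsto_jacobi_three_formula`), **`π²λ(2 − λ)/(4 sin(πλ/2)) → π` as `λ → 2`**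
(`tendsto_jacobi_four_formula`), **`2π(1 − λ)(1 + λ)(3 − λ)/(9 cos(πλ/2)) → 16/9` as `λ → 1`**
(`tendsto_jacobi_five_formula`), **`π²λ(2 − λ)(2 + λ)(4 − λ)/(64 sin(πλ/2)) → π/2` as `λ → 2`**
(`tendsto_jacobi_six_formula`) — each limit being the value of the transform there
(`C_k²` at `λ = 1`, the `L¹`-norm `2π/(k − 2)` at `λ = 2`). Nothing is claimed about (N).

Blind lane: Mathlib + the HodgeRepro2 prefix only; no sorry; axioms ⊆ {propext, Classical.choice,
Quot.sound}.
-/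

namespace Summit.Ventures.HodgeRepro2.T5SU11JacobiContinuity

open MeasureTheory MeasureTheory.Measure Metric Set Filter Topology
open T5SU11Unimodular T5SU11Fibration T5SU11Cartan T5HaarCircle T5BergmanCoefficient
  T5SU11FibrationHaar T5SU11SphericalFunction T5SU11SphericalSymmetry T5SU11SphericalTwo
  T5SU11JacobiIwasawa T5SU11JacobiTransform T5SU11XiTransform T5SU11JacobiThreeFour
  T5SU11AbelConstInteger T5SU11JacobiIntegerWeight
open scoped Real

/-! ### Differentiability of the Gamma factors -/

/-- `Γ` is differentiable at every positive argument. -/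
lemma differentiableAt_Gamma_of_pos {s : ℝ} (hs : 0 < s) : DifferentiableAt ℝ Real.Gamma s :=
  Real.differentiableAt_Gamma fun m => ne_of_gt (by have := Nat.cast_nonneg (α := ℝ) m; linarith)

/-- `λ ↦ Γ((k − λ)/2)` is differentiable at every `λ < k`. -/
lemma differentiableAt_Gamma_sub_div_two {k lam : ℝ} (h : lam < k) :
    DifferentiableAt ℝ (fun lam => Real.Gamma ((k - lam) / 2)) lam := by
  have h1 : DifferentiableAt ℝ Real.Gamma ((fun lam : ℝ => (k - lam) / 2) lam) :=
    differentiableAt_Gamma_of_pos (by simp only; linarith)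
  have hf : DifferentiableAt ℝ (fun lam : ℝ => (k - lam) / 2) lam := by fun_prop
  exact DifferentiableAt.comp (g := Real.Gamma) lam h1 hf

/-- `λ ↦ Γ((k + λ)/2 − 1)` is differentiable at every `λ > 2 − k`. -/
lemma differentiableAt_Gamma_add_div_two_sub_one {k lam : ℝ} (h : 2 < k + lam) :
    DifferentiableAt ℝ (fun lam => Real.Gamma ((k + lam) / 2 - 1)) lam := by
  have h1 : DifferentiableAt ℝ Real.Gamma ((fun lam : ℝ => (k + lam) / 2 - 1) lam) :=
    differentiableAt_Gamma_of_pos (by simp only; linarith)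
  have hf : DifferentiableAt ℝ (fun lam : ℝ => (k + lam) / 2 - 1) lam := by fun_prop
  exact DifferentiableAt.comp (g := Real.Gamma) lam h1 hf

/-- The Gamma-quotient formula for `m̂_k` is differentiable at every point of the strip. -/
lemma differentiableAt_jacobi_formula {k lam : ℝ} (h1 : lam < k) (h2 : 2 < k + lam) :
    DifferentiableAt ℝ (fun lam => 2 ^ (k - 2) * (√π * Real.Gamma ((k - 1) / 2) / Real.Gamma (k / 2))
      * (Real.Gamma ((k - lam) / 2) * Real.Gamma ((k + lam) / 2 - 1) / Real.Gamma (k - 1))) lam :=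
  (differentiableAt_const _).mul
    (((differentiableAt_Gamma_sub_div_two h1).mul
      (differentiableAt_Gamma_add_div_two_sub_one h2)).div_const _)

section measure

variable [MeasurableSpace Circle] [BorelSpace Circle]

/-! ### Continuity and differentiability of the transform -/

/-- On the open strip the transform coincides with the Gamma-quotient formula (as functions). -/
lemma jacobi_eventuallyEq_formula {k lam : ℝ} (hk : 1 < k) (h1 : lam < k) (h2 : 2 < k + lam) :
    (fun lam => ∫ g, (1 - ‖orbit g‖ ^ 2) ^ (k / 2) * sph lam g ∂(nu haarCircle))
      =ᶠ[𝓝 lam] fun lam => 2 ^ (k - 2) * (√π * Real.Gamma ((k - 1) / 2) / Real.Gamma (k / 2))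
        * (Real.Gamma ((k - lam) / 2) * Real.Gamma ((k + lam) / 2 - 1) / Real.Gamma (k - 1)) := by
  filter_upwards [Ioo_mem_nhds (show 2 - k < lam by linarith) h1] with mu hmu
  exact integral_orbit_rpow_mul_sph hk hmu.2 (by linarith [hmu.1])

/-- **Differentiability at every point of the strip**: `λ ↦ m̂_k(λ)` is differentiable at `λ` for
`2 − k < λ < k`. -/
theorem differentiableAt_jacobi {k lam : ℝ} (hk : 1 < k) (h1 : lam < k) (h2 : 2 < k + lam) :
    DifferentiableAt ℝ
      (fun lam => ∫ g, (1 - ‖orbit g‖ ^ 2) ^ (k / 2) * sph lam g ∂(nu haarCircle)) lam :=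
  (differentiableAt_jacobi_formula h1 h2).congr_of_eventuallyEq (jacobi_eventuallyEq_formula hk h1 h2)

/-- **Continuity at every point of the strip**. -/
theorem continuousAt_jacobi {k lam : ℝ} (hk : 1 < k) (h1 : lam < k) (h2 : 2 < k + lam) :
    ContinuousAt
      (fun lam => ∫ g, (1 - ‖orbit g‖ ^ 2) ^ (k / 2) * sph lam g ∂(nu haarCircle)) lam :=
  (differentiableAt_jacobi hk h1 h2).continuousAt

/-- **`λ ↦ m̂_k(λ)` is differentiable on the strip `(2 − k, k)`**. -/
theorem differentiableOn_jacobi {k : ℝ} (hk : 1 < k) :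
    DifferentiableOn ℝ
      (fun lam => ∫ g, (1 - ‖orbit g‖ ^ 2) ^ (k / 2) * sph lam g ∂(nu haarCircle)) (Ioo (2 - k) k) :=
  fun lam hlam => (differentiableAt_jacobi hk hlam.2 (by linarith [hlam.1])).differentiableWithinAt

/-- **`λ ↦ m̂_k(λ)` is continuous on the strip `(2 − k, k)`**. -/
theorem continuousOn_jacobi {k : ℝ} (hk : 1 < k) :
    ContinuousOn
      (fun lam => ∫ g, (1 - ‖orbit g‖ ^ 2) ^ (k / 2) * sph lam g ∂(nu haarCircle)) (Ioo (2 - k) k) :=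
  (differentiableOn_jacobi hk).continuousOn

/-! ### The critical parameter is a critical point -/

/-- **`λ = 1` is a local minimum of the transform** (`T5SU11XiTransform.xi_transform_le_jacobi`). -/
theorem isLocalMin_jacobi_one {k : ℝ} (hk : 1 < k) :
    IsLocalMin (fun lam => ∫ g, (1 - ‖orbit g‖ ^ 2) ^ (k / 2) * sph lam g ∂(nu haarCircle)) 1 := by
  filter_upwards [Ioo_mem_nhds (show 2 - k < (1 : ℝ) by linarith) hk] with lam hlam
  exact xi_transform_le_jacobi hk hlam.2 (by linarith [hlam.1])

/-- **Fermat**: `(d/dλ) m̂_k(λ) |_{λ=1} = 0`. -/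
theorem deriv_jacobi_one {k : ℝ} (hk : 1 < k) :
    deriv (fun lam => ∫ g, (1 - ‖orbit g‖ ^ 2) ^ (k / 2) * sph lam g ∂(nu haarCircle)) 1 = 0 :=
  (isLocalMin_jacobi_one hk).deriv_eq_zero

/-- **`m̂_k` has derivative `0` at `λ = 1`** (differentiability + Fermat). -/
theorem hasDerivAt_jacobi_one {k : ℝ} (hk : 1 < k) :
    HasDerivAt (fun lam => ∫ g, (1 - ‖orbit g‖ ^ 2) ^ (k / 2) * sph lam g ∂(nu haarCircle)) 0 1 := by
  have h := (differentiableAt_jacobi hk hk (by linarith)).hasDerivAt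
  rwa [deriv_jacobi_one hk] at h

/-! ### The removable singularities of the elementary formulas -/

/-- The transform tends to its value along the punctured neighbourhood of a point of the strip. -/
lemma tendsto_jacobi_punctured {k lam : ℝ} (hk : 1 < k) (h1 : lam < k) (h2 : 2 < k + lam) :
    Tendsto (fun lam => ∫ g, (1 - ‖orbit g‖ ^ 2) ^ (k / 2) * sph lam g ∂(nu haarCircle)) (𝓝[≠] lam)
      (𝓝 (∫ g, (1 - ‖orbit g‖ ^ 2) ^ (k / 2) * sph lam g ∂(nu haarCircle))) :=
  (continuousAt_jacobi hk h1 h2).tendsto.mono_left nhdsWithin_le_nhds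

/-- **Weight 3 at `λ = 1`**: `2π(1 − λ)/cos(πλ/2) → 4` as `λ → 1` (the value `C_3² = 4` of the transform,
`T5SU11JacobiThreeFour.integral_orbit_rpow_three_mul_sph_one`). -/
theorem tendsto_jacobi_three_formula :
    Tendsto (fun lam => 2 * π * (1 - lam) / Real.cos (π * lam / 2)) (𝓝[≠] 1) (𝓝 4) := by
  have h := tendsto_jacobi_punctured (k := 3) (lam := 1) (by norm_num) (by norm_num) (by norm_num)
  rw [integral_orbit_rpow_three_mul_sph_one] at h
  refine h.congr' ?_
  have hI : Ioo (-1 : ℝ) 3 ∈ 𝓝[≠] (1 : ℝ) :=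
    nhdsWithin_le_nhds (Ioo_mem_nhds (by norm_num) (by norm_num))
  filter_upwards [hI, self_mem_nhdsWithin] with lam hlam hne
  exact integral_orbit_rpow_three_mul_sph hlam.1 hlam.2 (Set.mem_compl_singleton_iff.mp hne)

/-- **Weight 4 at `λ = 2`**: `π²λ(2 − λ)/(4 sin(πλ/2)) → π` as `λ → 2` (the `L¹`-norm of `m_4`,
`φ_2 ≡ 1`). -/
theorem tendsto_jacobi_four_formula :
    Tendsto (fun lam => π ^ 2 * lam * (2 - lam) / (4 * Real.sin (π * lam / 2))) (𝓝[≠] 2) (𝓝 π) := by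
  have h := tendsto_jacobi_punctured (k := 4) (lam := 2) (by norm_num) (by norm_num) (by norm_num)
  have h4 : ∫ g, (1 - ‖orbit g‖ ^ 2) ^ ((4 : ℝ) / 2) * sph 2 g ∂(nu haarCircle) = π := by
    simp only [sph_two, mul_one]
    exact integral_orbit_rpow_four
  rw [h4] at h
  refine h.congr' ?_
  have hI : Ioo (0 : ℝ) 4 ∈ 𝓝[≠] (2 : ℝ) :=
    nhdsWithin_le_nhds (Ioo_mem_nhds (by norm_num) (by norm_num))
  filter_upwards [hI, self_mem_nhdsWithin] with lam hlam hne
  exact integral_orbit_rpow_four_mul_sph hlam.1 hlam.2 (Set.mem_compl_singleton_iff.mp hne)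

/-- **Weight 5 at `λ = 1`**: `2π(1 − λ)(1 + λ)(3 − λ)/(9 cos(πλ/2)) → 16/9` as `λ → 1` (the value
`C_5² = 16/9`, `T5SU11AbelConstInteger.integral_orbit_rpow_five_mul_sph_one`). -/
theorem tendsto_jacobi_five_formula :
    Tendsto (fun lam => 2 * π * (1 - lam) * (1 + lam) * (3 - lam) / (9 * Real.cos (π * lam / 2)))
      (𝓝[≠] 1) (𝓝 (16 / 9)) := by
  have h := tendsto_jacobi_punctured (k := 5) (lam := 1) (by norm_num) (by norm_num) (by norm_num)
  rw [integral_orbit_rpow_five_mul_sph_one] at h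
  refine h.congr' ?_
  have hI : Ioo (-1 : ℝ) 3 ∈ 𝓝[≠] (1 : ℝ) :=
    nhdsWithin_le_nhds (Ioo_mem_nhds (by norm_num) (by norm_num))
  filter_upwards [hI, self_mem_nhdsWithin] with lam hlam hne
  have hne' : lam ≠ 1 := Set.mem_compl_singleton_iff.mp hne
  have hc : Real.cos (π * lam / 2) ≠ 0 := by
    rw [← Real.sin_add_pi_div_two, show π * lam / 2 + π / 2 = π * ((lam + 1) / 2) by ring]
    exact sin_pi_mul_ne_zero (by linarith [hlam.1]) (by linarith [hlam.2]) (fun h => hne' (by linarith))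
  exact integral_orbit_rpow_five_mul_sph (by linarith [hlam.1]) (by linarith [hlam.2]) hc

/-- **Weight 6 at `λ = 2`**: `π²λ(2 − λ)(2 + λ)(4 − λ)/(64 sin(πλ/2)) → π/2` as `λ → 2` (the `L¹`-norm
`2π/(6 − 2)` of `m_6`, `φ_2 ≡ 1`). -/
theorem tendsto_jacobi_six_formula :
    Tendsto (fun lam => π ^ 2 * lam * (2 - lam) * (2 + lam) * (4 - lam) / (64 * Real.sin (π * lam / 2)))
      (𝓝[≠] 2) (𝓝 (π / 2)) := by
  have h := tendsto_jacobi_punctured (k := 6) (lam := 2) (by norm_num) (by norm_num) (by norm_num)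
  have h6 : ∫ g, (1 - ‖orbit g‖ ^ 2) ^ ((6 : ℝ) / 2) * sph 2 g ∂(nu haarCircle) = π / 2 := by
    simp only [sph_two, mul_one]
    rw [integral_orbit_rpow_nu (by norm_num)]
    ring
  rw [h6] at h
  refine h.congr' ?_
  have hI : Ioo (0 : ℝ) 4 ∈ 𝓝[≠] (2 : ℝ) :=
    nhdsWithin_le_nhds (Ioo_mem_nhds (by norm_num) (by norm_num))
  filter_upwards [hI, self_mem_nhdsWithin] with lam hlam hne
  have hne' : lam ≠ 2 := Set.mem_compl_singleton_iff.mp hne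
  have hs : Real.sin (π * lam / 2) ≠ 0 := by
    rw [show π * lam / 2 = π * (lam / 2) by ring]
    exact sin_pi_mul_ne_zero (by linarith [hlam.1]) (by linarith [hlam.2]) (fun h => hne' (by linarith))
  exact integral_orbit_rpow_six_mul_sph (by linarith [hlam.1]) (by linarith [hlam.2]) hs

end measure

end Summit.Ventures.HodgeRepro2.T5SU11JacobiContinuity
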